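import Summits.CriticalPhenomena.PercolationContinuityZ3.Theorems.PercNearOneGluingNoHeavyLowerTailSahiMixtureHereditaryCex6

/-!
# The hereditary mixture conjecture fails already at FIVE events: `n* = 5` (H-MIX(4) is a theorem, H-MIX(5) is false) — unconditionally in the kernel

Support file of the one-cut programme (crux `NoHeavyLowerTail`, stmt-CriticalPhenomena-4575; cell `prim-masterthm`, seat P3, gen 8;
`run/shared/lean/prim/prim-masterthm/prim-masterthm-p3/HIERARCHY.md` §15).  Continues `…SahiMixtureHereditaryRefutation` (gen 6: the six-event law `cex6Weight` on the
14 atoms of `{0,1,2}^3`, nested pairs `P_j ⊆ Q_j`) and `…SahiMixtureHereditaryCex6` (lead gen 33: EVERY family of principal up-sets of that law is hereditarily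
all-orders positive, `hereditaryAllOrders_upEv`).  Gen 7 proved H-MIX(4) (`hereditaryMixture_four`); gen 6 refuted H-MIX(6).  This file closes the gap:
* `cex5A = (Q_0, Q_1, P_0, P_1, P_2)` — FIVE of the six events (drop `Q_2`); `hereditaryAllOrders_cex5 : HereditaryAllOrders cex6Weight cex5A` (free, by
  `hereditaryAllOrders_upEv`).
* OR the coin into `F = {P_0, P_1}` only and take the slots `K = ({Q_0,P_0}, {Q_1,P_1}, {P_2})` (irredundant, `m = 3`): the members are
  `B = (P_0 ∪ (H∩Q_0), P_1 ∪ (H∩Q_1), P_2) = (mixEv P_0 Q_0, mixEv P_1 Q_1, mixEv P_2 P_2)` (`cex5_slots_eq`) — the generic three-slot cell with ONE DEGENERATE PAIR.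
  Its Bernstein coefficients are `(1387/15625000, −2682/1953125, −2399/12500000, 79377/62500000)` (seat script `work/hmix5/cex5_check.py`, two exact code paths)
  and **`sahiE_three_cex5`: at `h = 1/2` the cubic row is `−6447/250000000 < 0`** (kernel fact, via `sahiE_three_mixEv_eq` and the seventeen moments).
* **`not_hereditaryMixturePositivity_five`**: the `n = 5` slice of `HereditaryMixturePositivity` (the statement gen 7 proved for `n = 4` as
  `hereditaryMixturePositivity_four`) is FALSE.  So the threshold is `n* = 5`: the hereditary class `𝒦_n` is preserved under OR-mixing an independent coin
  into a sub-collection iff `n ≤ 4`.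
HOW FOUND: kit job j108775 of this seat — exact sweep of all canonical irredundant cells of five events over all five-member families of principal up-sets of
the two known GC(3)-violating laws (cex6 /500, ttrl cp-mix's /41): the ONLY hits are the sub-families `(Q_j,Q_k,P_0,P_1,P_2)` with the coin in the two `P`'s
under their `Q`'s; a parallel SLSQP census over all 198 canonical irredundant cells × laws on the 32 free Venn atoms (kit j108945/j108949/j108951/j108952)
classifies the violated cell types (HIERARCHY §15).  HONEST FRAMING: a law-level statement; nothing here bears on the comb / product-measure level (`SahiCombHereditary.CombHereditaryMixture`),
on H-MIX(4), or on Sahi's `C_k`. [this work]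
-/

noncomputable section

open scoped Classical

namespace Summit.CriticalPhenomena.PercolationContinuityZ3.Theorems

open Finset Function
open Literature.Combinatorics.Sahi2008
open Literature.Probability.Percolation.DecisionTree (ind ind_of_mem ind_of_not_mem ind_nonneg)

namespace SahiMixture

/-! ### The five events -/

/-- The five-member family `(Q_0, Q_1, P_0, P_1, P_2)` of the six-event counterexample law (drop `Q_2`). [this work] -/
def cex5A : Fin 5 → Set (Fin 14) := ![cex6Q 0, cex6Q 1, cex6P 0, cex6P 1, cex6P 2]

/-- Their generators as level vectors: `Q_0 = upEv e_0`, `Q_1 = upEv e_1`, `P_j = upEv 2e_j`. [this work] -/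
def gen5 : Fin 5 → Lvl := ![![1, 0, 0], ![0, 1, 0], ![2, 0, 0], ![0, 2, 0], ![0, 0, 2]]

/-- `cex5A` is a family of principal up-sets of the level vectors. [this work] -/
theorem cex5A_eq_upEv : cex5A = fun i => upEv (gen5 i) := by
  obtain ⟨q0, q1, -⟩ := cex6Q_eq_upEv
  obtain ⟨p0, p1, p2⟩ := cex6P_eq_upEv
  funext i
  fin_cases i
  · exact q0
  · exact q1
  · exact p0
  · exact p1
  · exact p2

/-- **The five events are hereditarily all-orders positive** (every family of principal up-sets of `cex6Weight` is: `hereditaryAllOrders_upEv`). [this work] -/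
theorem hereditaryAllOrders_cex5 : HereditaryAllOrders cex6Weight cex5A := by
  rw [cex5A_eq_upEv]
  exact hereditaryAllOrders_upEv gen5

/-- The three extra moments of the degenerate third pair: `μ(Q_0∩P_2) = μ(Q_1∩P_2) = 39/100`, `μ(Q_0∩Q_1∩P_2) = 31/125`. [this work] -/
theorem cex5_moments :
    ex cex6Weight (ind (cex6Q 0) * ind (cex6P 2)) = 39/100 ∧ ex cex6Weight (ind (cex6Q 1) * ind (cex6P 2)) = 39/100 ∧
    ex cex6Weight (ind (cex6Q 0) * ind (cex6Q 1) * ind (cex6P 2)) = 31/125 := by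
  obtain ⟨q0, q1, -, -, -, p2⟩ := ind_cex6
  simp only [ex_def, q0, q1, p2, cex6Weight, Fin.sum_univ_succ, Fin.sum_univ_zero, Pi.mul_apply]
  simp; norm_num

/-! ### The negative row -/

/-- **OR-ing a fair coin into `P_0, P_1` only: the cubic row of `(P_0 ∪ (H∩Q_0), P_1 ∪ (H∩Q_1), P_2)` is `−6447/250000000 < 0`.**  (Bernstein coefficients
`(1387/15625000, −2682/1953125, −2399/12500000, 79377/62500000)`; the row is negative for all `h ∈ (0, 0.55)`.) [this work] -/
theorem sahiE_three_cex5 :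
    sahiE (coinWeight cex6Weight (1/2 : ℝ)) 3 ![ind (mixEv (cex6P 0) (cex6Q 0)), ind (mixEv (cex6P 1) (cex6Q 1)), ind (mixEv (cex6P 2) (cex6P 2))]
      = -6447/250000000 := by
  obtain ⟨p0, p1, p2, p01, p02, p12, p012, q0, q1, -, q01, -, -, -⟩ := cex6_moments
  obtain ⟨q0p2, q1p2, q01p2⟩ := cex5_moments
  rw [sahiE_three_mixEv_eq, sahiE_three, sahiE_three]
  simp only [p0, p1, p2, p01, p02, p12, p012, q0, q1, q01, q0p2, q1p2, q01p2]
  norm_num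

/-- The three slots `K = ({Q_0,P_0}, {Q_1,P_1}, {P_2})` of `cex5A` with the coin OR-ed into `P_0, P_1` are `(mixEv P_0 Q_0, mixEv P_1 Q_1, mixEv P_2 P_2)`. [this work] -/
theorem cex5_slots_eq :
    (fun j => ind (⋂ i ∈ (![({0, 2} : Finset (Fin 5)), {1, 3}, {4}] : Fin 3 → Finset (Fin 5)) j,
        orCoin (cex5A i) ((![false, false, true, true, false] : Fin 5 → Bool) i)))
      = ![ind (mixEv (cex6P 0) (cex6Q 0)), ind (mixEv (cex6P 1) (cex6Q 1)), ind (mixEv (cex6P 2) (cex6P 2))] := by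
  have hPQ : ∀ j : Fin 3, cex6Q j ∩ cex6P j = cex6P j := fun j => Set.inter_eq_right.2 (cex6P_subset_Q j)
  funext j
  fin_cases j
  · show ind (⋂ i ∈ ({0, 2} : Finset (Fin 5)), orCoin (cex5A i) ((![false, false, true, true, false] : Fin 5 → Bool) i)) = _
    rw [biInter_orCoin_eq_mixEv]
    have h1 : (⋂ i ∈ ({0, 2} : Finset (Fin 5)), cex5A i) = cex6P 0 := by
      rw [Finset.set_biInter_insert, Finset.set_biInter_singleton]; exact hPQ 0
    have h2 : (⋂ i ∈ ({0, 2} : Finset (Fin 5)).filter (fun i => (![false, false, true, true, false] : Fin 5 → Bool) i = false), cex5A i)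
        = cex6Q 0 := by
      have : ({0, 2} : Finset (Fin 5)).filter (fun i => (![false, false, true, true, false] : Fin 5 → Bool) i = false) = {0} := by decide
      rw [this, Finset.set_biInter_singleton]; rfl
    rw [h1, h2]; rfl
  · show ind (⋂ i ∈ ({1, 3} : Finset (Fin 5)), orCoin (cex5A i) ((![false, false, true, true, false] : Fin 5 → Bool) i)) = _
    rw [biInter_orCoin_eq_mixEv]
    have h1 : (⋂ i ∈ ({1, 3} : Finset (Fin 5)), cex5A i) = cex6P 1 := by
      rw [Finset.set_biInter_insert, Finset.set_biInter_singleton]; exact hPQ 1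
    have h2 : (⋂ i ∈ ({1, 3} : Finset (Fin 5)).filter (fun i => (![false, false, true, true, false] : Fin 5 → Bool) i = false), cex5A i)
        = cex6Q 1 := by
      have : ({1, 3} : Finset (Fin 5)).filter (fun i => (![false, false, true, true, false] : Fin 5 → Bool) i = false) = {1} := by decide
      rw [this, Finset.set_biInter_singleton]; rfl
    rw [h1, h2]; rfl
  · show ind (⋂ i ∈ ({4} : Finset (Fin 5)), orCoin (cex5A i) ((![false, false, true, true, false] : Fin 5 → Bool) i)) = _
    rw [biInter_orCoin_eq_mixEv]
    have h1 : (⋂ i ∈ ({4} : Finset (Fin 5)), cex5A i) = cex6P 2 := by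
      rw [Finset.set_biInter_singleton]; rfl
    have h2 : (⋂ i ∈ ({4} : Finset (Fin 5)).filter (fun i => (![false, false, true, true, false] : Fin 5 → Bool) i = false), cex5A i)
        = cex6P 2 := by
      have : ({4} : Finset (Fin 5)).filter (fun i => (![false, false, true, true, false] : Fin 5 → Bool) i = false) = {4} := by decide
      rw [this, Finset.set_biInter_singleton]; rfl
    rw [h1, h2]; rfl

/-! ### H-MIX(5) is false -/

/-- **THE HEREDITARY MIXTURE CONJECTURE FAILS AT FIVE EVENTS** — unconditionally: the `n = 5` slice of `HereditaryMixturePositivity` (proved for `n = 4` as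
`hereditaryMixturePositivity_four`) is false.  Witness: `cex6Weight`, `cex5A = (Q_0,Q_1,P_0,P_1,P_2)` (hereditarily all-orders positive), coin OR-ed into
`P_0, P_1`, slots `({Q_0,P_0},{Q_1,P_1},{P_2})`: Bernstein positivity of degree `3` would make the cubic row nonnegative at `h = 1/2`, but it is
`−6447/250000000`.  Hence `n* = 5`. [this work] -/
theorem not_hereditaryMixturePositivity_five :
    ¬ (∀ (α : Type) [Fintype α] (μ : α → ℝ), (∀ a, 0 ≤ μ a) → ∑ a, μ a = 1 →
        ∀ (A : Fin 5 → Set α) (F : Fin 5 → Bool), HereditaryAllOrders μ A →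
          ∀ (m : ℕ) (K : Fin m → Finset (Fin 5)),
            BernsteinPos m (fun h => sahiE (coinWeight μ h) m (fun j => ind (⋂ i ∈ K j, orCoin (A i) (F i))))) := by
  intro hmix
  have h := hmix (Fin 14) cex6Weight cex6Weight_nonneg sum_cex6Weight cex5A ![false, false, true, true, false] hereditaryAllOrders_cex5 3
    ![({0, 2} : Finset (Fin 5)), {1, 3}, {4}]
  have hnn := h.nonneg (h := (1/2 : ℝ)) (by norm_num) (by norm_num)
  rw [cex5_slots_eq, sahiE_three_cex5] at hnn
  norm_num at hnn

/-- **For every bias `h ∈ [0,1]` with `h = 1/2` the OR-mixed five-event family leaves the hereditary class**: `𝒦_5` is NOT preserved under OR-mixing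
(contrast `hereditaryAllOrders_orCoin_four`). [this work] -/
theorem not_hereditaryAllOrders_orCoin_cex5 :
    ¬ HereditaryAllOrders (coinWeight cex6Weight (1/2 : ℝ)) (fun i => orCoin (cex5A i) ((![false, false, true, true, false] : Fin 5 → Bool) i)) := by
  intro hher
  have hnn := hher 3 ![({0, 2} : Finset (Fin 5)), {1, 3}, {4}]
  rw [cex5_slots_eq, sahiE_three_cex5] at hnn
  norm_num at hnn

end SahiMixture

end Summit.CriticalPhenomena.PercolationContinuityZ3.Theorems

end
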